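import Summits.NavierStokesRegularity.NavierStokesRegularity.Theorems.ExtremiserTransienceNearExtremalTransienceExtremiserLiouvilleConstantSpeedAxialDossier
import Summits.NavierStokesRegularity.NavierStokesRegularity.Theorems.ExtremiserTransienceNearExtremalTransienceExtremiserLiouvilleConstantSpeedMultiplierAtomless
import Summits.NavierStokesRegularity.NavierStokesRegularity.Theorems.ExtremiserTransienceNearExtremalTransienceExtremiserLiouvilleConstantSpeedBlowDownSelfSimilar
import Summits.NavierStokesRegularity.NavierStokesRegularity.Theorems.ExtremiserTransienceNearExtremalTransienceExtremiserLiouvilleConstantSpeedJetH1Kill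
import HarnessLib

/-!
# Crux `ExtremiserTransience.NearExtremalTransience` (stmt-NavierStokesRegularity-21883), line `extremiser_liouville`,
# stub K1b — THE AXIAL DOSSIER, VERSION 2 (g6 final): the residue object handed over now also has NO ATOMS, is NOT an
# asymptotically conical jet, and violates EVERY annular `H¹` rate on energetic windows

`--supports stmt-NavierStokesRegularity-21883` (helper).  Author: prover seat `ns-el-k1b` (g6).  K1b VERBATIM follows if NO axial
residue object exists; compared with `stub_noAnalyticExtremal_of_noAxialResidueObject` (p687532) the object may additionally be
assumed to satisfy:
* (A)  the multiplier has no atoms (`μ{x₀} = 0`, `…ConstantSpeedMultiplierAtomless`);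
* (NC) it is not an asymptotically `(−1)`-homogeneous (conical) jet with two-sided linear excess-energy growth
  (`no_asymptoticallyHomogeneous_jet`);
* (NR) in the jet case, along NO sequence `Rₙ → ∞` with energetic windows (`e₀Rₙ ≤ ∫⁻_{B(Rₙx₁,RₙL₁)}‖w−c‖ₑ²`,
  `B(x₁,L₁+1) ⊆ {1/2<|y|<4}`) does the annular `H¹` rate `Rₙ∫⁻_{Rₙ/2<|y|<4Rₙ}‖Dw‖ₑ² ≤ A < ∞` hold (`axialJet_false_of_annular_H1rate`).
So the next seat must exclude: a thin (sub-conical, rate-violating) or pancake (super-conical) axial jet, or a flat slab.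

* `axialWindow_subset` : the concrete window `x₁ = 2e₂`, `L₁ = 1/2` satisfies the geometry hypothesis of (NR);
* `stub_noAnalyticExtremal_of_noAxialResidueObject₂` : the dossier.

WHAT THIS IS NOT: K1b is NOT proved; nothing here proves NS regularity. [folklore]
-/

noncomputable section

open Set Filter Topology MeasureTheory Metric Function
open scoped ENNReal NNReal Topology InnerProductSpace RealInnerProductSpace ContDiff Laplacian
open Literature.Analysis.FluidPDE Literature.Analysis

namespace Summit.NavierStokesRegularity.NavierStokesRegularity.Theorems

-- the problem directory repeats the summit name (`NavierStokesRegularity/NavierStokesRegularity`)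
set_option linter.dupNamespace false

namespace ExtremiserLiouville

open DepletionLadder.KStar DepletionLadder.KStar.HalfSpace

/-- **A concrete energetic-window geometry**: with `x₁ = 2e₂` and `L₁ = 1/2`, `B(x₁, L₁+1) ⊆ {1/2 < |y| < 4}` — the window
hypothesis of (NR) below / of `axialJet_false_of_annular_H1rate`. [folklore] -/
theorem axialWindow_subset :
    ball ((2 : ℝ) • EuclideanSpace.single (2 : Fin 3) (1 : ℝ)) (2⁻¹ + 1) ⊆ ball (0 : E3) 4 \ closedBall (0 : E3) 2⁻¹ := by
  intro y hy
  have hn : ‖(2 : ℝ) • EuclideanSpace.single (2 : Fin 3) (1 : ℝ)‖ = 2 := by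
    rw [norm_smul, Real.norm_eq_abs, abs_of_pos two_pos]
    simp
  rw [mem_ball, dist_eq_norm] at hy
  rw [Set.mem_sdiff, mem_ball_zero_iff, mem_closedBall_zero_iff, not_le]
  constructor
  · calc ‖y‖ = ‖(y - (2 : ℝ) • EuclideanSpace.single (2 : Fin 3) (1 : ℝ)) + (2 : ℝ) • EuclideanSpace.single (2 : Fin 3) (1 : ℝ)‖ := by
          rw [sub_add_cancel]
      _ ≤ ‖y - (2 : ℝ) • EuclideanSpace.single (2 : Fin 3) (1 : ℝ)‖ + ‖(2 : ℝ) • EuclideanSpace.single (2 : Fin 3) (1 : ℝ)‖ :=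
          norm_add_le _ _
      _ < 4 := by rw [hn]; linarith
  · have h := norm_sub_norm_le ((2 : ℝ) • EuclideanSpace.single (2 : Fin 3) (1 : ℝ)) y
    rw [hn, norm_sub_rev] at h
    linarith

/-- **AXIAL DOSSIER v2 (g6 final).**  K1b VERBATIM ⟸ no axial residue object with: the residue regularity/size data, the
multiplier (finite, exact mass, identity, zero barycentre), (S₀), (V₀), and NEW: (A) no atoms, (NC) no asymptotically conical
jet, (NR) no annular `H¹` rate on energetic windows — and the flat-or-jet alternative.  (K1b itself is NOT proved here.)
[folklore] -/
theorem stub_noAnalyticExtremal_of_noAxialResidueObject₂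
    (hres : ∀ (w : E3 → E3) (c : E3) (M : ℝ) (μ : Measure E3),
      AnalyticOnNhd ℝ w Set.univ → ContDiff ℝ (⊤ : ℕ∞) w → VectorCalculus.IsDivFree w →
      (∃ B : ℝ, ∀ x, ‖fderiv ℝ w x‖ ≤ B) → (∫⁻ x, ‖iteratedFDeriv ℝ 1 w x‖ₑ ^ 2 < ⊤) → (∫⁻ x, ‖iteratedFDeriv ℝ 2 w x‖ₑ ^ 2 < ⊤) →
      (∀ x, ‖w x‖ = M) → 0 < M → c 0 = 0 → c 1 = 0 → c 2 ≠ 0 → ‖c‖ = M →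
      Tendsto (fun x => w x - c) (cocompact E3) (𝓝 0) → MemLp (fun x => w x - c) 6 volume →
      0 < M * Real.sqrt (Zen w) * Real.sqrt (Wpa w) → kStar * M * Real.sqrt (Zen w) * Real.sqrt (Wpa w) = |Jst w| →
      -- the multiplier: finite, exact mass, the multiplier equation, zero barycentre
      IsFiniteMeasure μ → M ^ 2 * μ.real univ = Jst w ^ 2 →
      (∀ φ : E3 → E3, ContDiff ℝ ∞ φ → HasCompactSupport φ → VectorCalculus.IsDivFree φ →
        Jst w * J1 w φ - kStar ^ 2 * M ^ 2 * (Wpa w * A1 w φ + Zen w * C1 w φ) = ∫ x, ⟪w x, φ x⟫_ℝ ∂μ) →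
      (∫ x, w x ∂μ) = 0 →
      -- (S₀) the Stokeslet law without point force
      (∀ (c' : E3) (Ψ : E3 → E3), ContDiff ℝ ∞ Ψ → HasCompactSupport Ψ → VectorCalculus.IsDivFree Ψ →
        Tendsto (fun R : ℝ => kStar ^ 2 * M ^ 2 * Wpa w * (R⁻¹ * R⁻¹ * ∫ x, ⟪w x - c', (Δ Ψ) (R⁻¹ • x)⟫_ℝ)) atTop (𝓝 0)) →
      -- (V₀) the blow-down vorticity vanishes in `𝒟′`
      (∀ B : E3 → E3, ContDiff ℝ ∞ B → HasCompactSupport B →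
        Tendsto (fun R : ℝ => R⁻¹ * ∫ x, ⟪curl w x, B (R⁻¹ • x)⟫_ℝ) atTop (𝓝 0)) →
      -- (A) NEW: the multiplier has no atoms
      (∀ x₀ : E3, μ {x₀} = 0) →
      -- (NC) NEW: not an asymptotically conical jet (two-sided linear growth ⇒ no `(−1)`-homogeneous leading term)
      (∀ (Cg : ℝ), 0 ≤ Cg → (∀ ρ : ℝ, 1 ≤ ρ → ∫⁻ x in ball (0 : E3) ρ, ‖w x - c‖ₑ ^ 2 ≤ ENNReal.ofReal (Cg * ρ)) →
        ∀ (e₀ L₀ : ℝ), 0 < e₀ → 0 < L₀ →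
        (∀ R : ℝ, 1 ≤ R → ENNReal.ofReal (e₀ * R) ≤ ∫⁻ x in ball (0 : E3) (R * L₀), ‖w x - c‖ₑ ^ 2) →
        ∀ U : E3 → E3, AEStronglyMeasurable U volume → (∀ R : ℝ, 0 < R → ∀ x, R • U (R • x) = U x) →
        ¬ (∀ L : ℝ, 0 < L →
          Tendsto (fun R : ℝ => ENNReal.ofReal R⁻¹ * ∫⁻ x in ball (0 : E3) (R * L), ‖w x - c - U x‖ₑ ^ 2) atTop (𝓝 0))) →
      -- (NR) NEW: in the jet case, no annular `H¹` rate along energetic windows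
      ((∀ T : ℝ, 0 < T → Integrable (fun x => {x : E3 | |x 2| ≤ T}.indicator (fun x => ‖w x - c‖ ^ 2) x) volume) →
        ∀ (E₀ : ℝ), 0 < E₀ → (∀ s : ℝ, (∫ x, deriv Real.smoothTransition (x 2 - s) * ‖w x - c‖ ^ 2) = E₀) →
        ∀ (Rn : ℕ → ℝ), (∀ n, 1 ≤ Rn n) → Tendsto Rn atTop atTop →
        ∀ (x₁ : E3) (L₁ : ℝ), ball x₁ (L₁ + 1) ⊆ ball (0 : E3) 4 \ closedBall (0 : E3) 2⁻¹ →
        ∀ (A : ℝ≥0∞), A ≠ ⊤ → ∀ (e₀ : ℝ), 0 < e₀ →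
        (∀ n, ENNReal.ofReal (e₀ * Rn n) ≤ ∫⁻ y in ball (Rn n • x₁) (Rn n * L₁), ‖w y - c‖ₑ ^ 2) →
        ¬ (∀ n, ENNReal.ofReal (Rn n) * ∫⁻ y in ball (0 : E3) (4 * Rn n) \ closedBall (0 : E3) (2⁻¹ * Rn n),
          ‖fderiv ℝ w y‖ₑ ^ 2 ≤ A)) →
      -- (F/J) the axial flat-or-jet alternative is excluded
      ¬ ((∃ T : ℝ, 0 < T ∧ ¬ Integrable (fun x => {x : E3 | |x 2| ≤ T}.indicator (fun x => ‖w x - c‖ ^ 2) x) volume) ∨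
         ((∀ T : ℝ, 0 < T → Integrable (fun x => {x : E3 | |x 2| ≤ T}.indicator (fun x => ‖w x - c‖ ^ 2) x) volume) ∧
           ∃ E₀ : ℝ, 0 < E₀ ∧ ∀ s : ℝ, (∫ x, deriv Real.smoothTransition (x 2 - s) * ‖w x - c‖ ^ 2) = E₀))) :
    ¬ ∃ (w : EuclideanSpace ℝ (Fin 3) → EuclideanSpace ℝ (Fin 3)), AnalyticOnNhd ℝ w Set.univ ∧ (ContDiff ℝ (⊤ : ℕ∞) w ∧ Literature.Analysis.FluidPDE.VectorCalculus.IsDivFree w ∧ (∃ B : ℝ, ∀ x, ‖fderiv ℝ w x‖ ≤ B) ∧ (∫⁻ x, ‖iteratedFDeriv ℝ 1 w x‖ₑ ^ 2 < ⊤) ∧ (∫⁻ x, ‖iteratedFDeriv ℝ 2 w x‖ₑ ^ 2 < ⊤) ∧ ∃ M : ℝ, (∀ x, ‖w x‖ ≤ M) ∧ 0 < M * Real.sqrt (∫ x, ‖Literature.Analysis.FluidPDE.curl w x‖ ^ 2) * Real.sqrt (∫ x, Literature.Analysis.FluidPDE.frobeniusNormSq (fderiv ℝ (Literature.Analysis.FluidPDE.curl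 w) x)) ∧ (sInf {κ : ℝ | (∀ (v : EuclideanSpace ℝ (Fin 3) → EuclideanSpace ℝ (Fin 3)) (M B : ℝ), ContDiff ℝ (⊤ : ℕ∞) v → Literature.Analysis.FluidPDE.VectorCalculus.IsDivFree v → (∀ x, ‖v x‖ ≤ M) → (∀ x, ‖fderiv ℝ v x‖ ≤ B) → (∫⁻ x, ‖iteratedFDeriv ℝ 0 v x‖ₑ ^ 2 < ⊤) → (∫⁻ x, ‖iteratedFDeriv ℝ 1 v x‖ₑ ^ 2 < ⊤) → (∫⁻ x, ‖iteratedFDeriv ℝ 2 v x‖ₑ ^ 2 < ⊤) → |∫ x, ⟪Literature.Analysis.FluidPDE.curl v x, fderiv ℝ v x (Literature.Analysis.FluidPDE.curl v x)⟫_ℝ| ≤ κ * M * Real.sqrt (∫ x, ‖Literature.Analysis.FluidPDE.curl v x‖ ^ 2) * Real.sqrt (∫ x, Literature.Analysis.FluidPDE.frobeniusNormSq (fderiv ℝ (Literature.Analysis.FluidPDE.curl v) x)))}) * M * Real.sqrt (∫ x, ‖Literature.Analysis.FluidPDE.curl w x‖ ^ 2) * Real.sqrt (∫ x, Literature.Analysis.FluidPDE.frobeniusNormSq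 (fderiv ℝ (Literature.Analysis.FluidPDE.curl w) x)) ≤ |∫ x, ⟪Literature.Analysis.FluidPDE.curl w x, fderiv ℝ w x (Literature.Analysis.FluidPDE.curl w x)⟫_ℝ|) := by
  refine stub_noAnalyticExtremal_of_noAxialResidueObject
    fun w c M μ han hcd hdiv hB h1 h2 hM hMpos hc0 hc1 hc2 hcM hfar hL6 hpos heq hfin hmass hμ hb hS0 hV0 => ?_
  haveI := hfin
  have hc : c ≠ 0 := fun h => hc2 (by simp [h])
  -- (A)
  have hA : ∀ x₀ : E3, μ {x₀} = 0 := fun x₀ => multiplier_measure_singleton_eq_zero hcd hMpos hM μ hμ x₀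
  -- (NC)
  have hNC : ∀ (Cg : ℝ), 0 ≤ Cg → (∀ ρ : ℝ, 1 ≤ ρ → ∫⁻ x in ball (0 : E3) ρ, ‖w x - c‖ₑ ^ 2 ≤ ENNReal.ofReal (Cg * ρ)) →
      ∀ (e₀ L₀ : ℝ), 0 < e₀ → 0 < L₀ →
      (∀ R : ℝ, 1 ≤ R → ENNReal.ofReal (e₀ * R) ≤ ∫⁻ x in ball (0 : E3) (R * L₀), ‖w x - c‖ₑ ^ 2) →
      ∀ U : E3 → E3, AEStronglyMeasurable U volume → (∀ R : ℝ, 0 < R → ∀ x, R • U (R • x) = U x) →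
      ¬ (∀ L : ℝ, 0 < L →
        Tendsto (fun R : ℝ => ENNReal.ofReal R⁻¹ * ∫⁻ x in ball (0 : E3) (R * L), ‖w x - c - U x‖ₑ ^ 2) atTop (𝓝 0)) :=
    fun Cg hCg hgr e₀ L₀ he₀ hL₀ hlow U hU hhom hrem =>
      no_asymptoticallyHomogeneous_jet hcd hdiv hM h1 h2 hpos μ hμ hc hcM hL6 hCg hgr he₀ hL₀ hlow hU hhom hrem
  -- (NR)
  have hNR : (∀ T : ℝ, 0 < T → Integrable (fun x => {x : E3 | |x 2| ≤ T}.indicator (fun x => ‖w x - c‖ ^ 2) x) volume) →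
      ∀ (E₀ : ℝ), 0 < E₀ → (∀ s : ℝ, (∫ x, deriv Real.smoothTransition (x 2 - s) * ‖w x - c‖ ^ 2) = E₀) →
      ∀ (Rn : ℕ → ℝ), (∀ n, 1 ≤ Rn n) → Tendsto Rn atTop atTop →
      ∀ (x₁ : E3) (L₁ : ℝ), ball x₁ (L₁ + 1) ⊆ ball (0 : E3) 4 \ closedBall (0 : E3) 2⁻¹ →
      ∀ (A : ℝ≥0∞), A ≠ ⊤ → ∀ (e₀ : ℝ), 0 < e₀ →
      (∀ n, ENNReal.ofReal (e₀ * Rn n) ≤ ∫⁻ y in ball (Rn n • x₁) (Rn n * L₁), ‖w y - c‖ₑ ^ 2) →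
      ¬ (∀ n, ENNReal.ofReal (Rn n) * ∫⁻ y in ball (0 : E3) (4 * Rn n) \ closedBall (0 : E3) (2⁻¹ * Rn n),
        ‖fderiv ℝ w y‖ₑ ^ 2 ≤ A) :=
    fun hslab E₀ hE0 hE Rn hRn1 hRn x₁ L₁ hwin A hAtop e₀ he₀ hlow hann =>
      axialJet_false_of_annular_H1rate hcd hdiv hM h1 h2 hpos μ hμ hc0 hc1 hc2 hcM hL6 hslab hE0 hE hRn1 hRn hwin hAtop
        hann he₀ hlow
  exact hres w c M μ han hcd hdiv hB h1 h2 hM hMpos hc0 hc1 hc2 hcM hfar hL6 hpos heq hfin hmass hμ hb hS0 hV0 hA hNC hNR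

end ExtremiserLiouville

end Summit.NavierStokesRegularity.NavierStokesRegularity.Theorems

end
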